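import Summits.ValiantsHypothesis.ValiantsHypothesis.Theorems.LacunarySymmetroidPencilTransfer

/-!
# LINE `valuative_door` (crux `WeakLifting`, stmt-ValiantsHypothesis-19561) — the support stub `PencilTransferPoly`
# of `Cruxes/WeakLifting/Lines/valuative_door.lean` (rev 2 @84c5f76c6d22), PROVED in its unfolded form

HONEST FRAMING.  Helper (cell `pub-symmetroid`, seat val-sym-lift-p1 g21, 2026-08-29; `--supports 19561 --as helper`).  The line's
stub `stub_pencilTransferPoly` («PencilTransfer at POLYNOMIAL level», tag δ/S) asks for the crux `PencilTransfer` (stmt-18051, proved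
in the tree by `…Theorems.LacunarySymmetroid.pencilTransfer_proof` in ROOT-FINSET currency) with the conclusion upgraded to a POLYNOMIAL
IDENTITY `det (Σ_l X^{(0 :: d n) l} • S_l) = f_n(X^{d n 0}, …)`.  The tree already holds every ingredient: `symmAffineRepr_of_isVPFamily_complex`
(descent to `ℝ` + quasi-polynomial symmetric affine representation), `pencilDet_of_affine` (restriction to the monomial curve AS A
POLYNOMIAL IDENTITY) and `pencilTransfer_size_bound`; `pencilTransfer_pointwise` merely forgot the identity down to root finsets.  This
file re-assembles them without that last step.  The statement is the skeleton's `PencilTransferPoly` verbatim (it has no line-local defs),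
so the line file gets `stub_pencilTransferPoly` by `exact`.  A support stub of the line — NOT the crux `WeakLifting`, closes nothing on the
ledger by itself, no bearing on vW / vB / `ValRankOneLaw`, `TropicalB`, `MatrixDescartes` (18050) or VP ≠ VNP.  [assembly of tree theorems]
-/

set_option linter.dupNamespace false
set_option autoImplicit false

noncomputable section

namespace Summit.ValiantsHypothesis.ValiantsHypothesis.Theorems.KPlusLogSqLaw.ValDoor

open MvPolynomial Literature.Computability.AlgebraicComplexity
open Summit.ValiantsHypothesis.ValiantsHypothesis.Theorems.LacunarySymmetroid

/-- **`PencilTransferPoly` (the skeleton's statement, verbatim):** if the complexification of a real family is `VP`, its restriction to any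
monomial curve IS the determinant of a real SYMMETRIC lacunary pencil of quasi-polynomial size — as a polynomial identity, not only up to
root sets. [assembly: `symmAffineRepr_of_isVPFamily_complex` + `pencilDet_of_affine` + `pencilTransfer_size_bound`] -/
theorem pencilTransferPoly_unfolded :
    ∀ (v : ℕ → ℕ) (f : ∀ n, MvPolynomial (Fin (v n)) ℝ),
      Literature.Computability.AlgebraicComplexity.IsVPFamily (fun n => MvPolynomial.map (algebraMap ℝ ℂ) (f n)) →
      ∀ d : (n : ℕ) → Fin (v n) → ℕ, ∃ c : ℕ, ∀ n : ℕ, ∃ m : ℕ, m ≤ 2 ^ ((Nat.log 2 n + c) ^ c) ∧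
        ∃ S : Fin (v n + 1) → Matrix (Fin m) (Fin m) ℝ, (∀ l, (S l).IsSymm) ∧
          Matrix.det (∑ l, ((Polynomial.X : Polynomial ℝ) ^ (Fin.cons (α := fun _ => ℕ) (0 : ℕ) (d n) l)) •
              (S l).map Polynomial.C) =
            MvPolynomial.aeval (fun i => (Polynomial.X : Polynomial ℝ) ^ d n i) (f n) := by
  intro v f hf d
  obtain ⟨⟨c₀, hc₀⟩, hrep⟩ := symmAffineRepr_of_isVPFamily_complex v f hf
  refine ⟨c₀ + 11, fun n => ?_⟩
  obtain ⟨B, hsymm, hB⟩ := hrep n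
  refine ⟨4 * determinantalComplexity (f n) ^ 3 + 7, pencilTransfer_size_bound (hc₀ n),
    Fin.cons (constPart B) (fun i => LRPencil.coeffMat B i), ?_, ?_⟩
  · refine Fin.cases ?_ (fun i => ?_)
    · rw [Fin.cons_zero]; exact hsymm.map _
    · rw [Fin.cons_succ]; exact hsymm.map _
  · rw [pencilDet_of_affine B hB.1 (d n), hB.2]

end Summit.ValiantsHypothesis.ValiantsHypothesis.Theorems.KPlusLogSqLaw.ValDoor

end
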